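import Literature.MathematicalPhysics.QuantumLattice.TwistedSectorClassicalRate
import Mathlib.Analysis.SpecialFunctions.Complex.CircleAddChar
import HarnessLib

/-!
# 't Hooft's electric-flux free energy on the lattice torus: the `ℤ_N` Fourier transform of the twisted partition
# functions over the temporal twists (Nucl. Phys. B153 (1979) 141, eq. (5.4))

Topic `Literature/MathematicalPhysics/QuantumFieldTheory`; vocabulary of `QuantumLattice/TwistedBoundaryConditions.lean`
(`Plane d`, `Twist d G`, `twistOfTensor N n` — the twist `z_{μν} = e^{2πi n_{μν}/N}·𝟙 ∈ Z(SU(N))` of a twist tensor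
`n : Plane d → ZMod N`, `fundamentalRep`) and of `QuantumLattice/TwistedSectorClassicalRate.lean` (namespace `TwistedSector`:
`twistZ ρ z β L : ℝ`, 't Hooft's twisted functional integral `W{n; a_μ}` of the symmetric torus `(ℤ/Lℤ)^d` with Wilson's action).
DEFINITIONS with elementary API; no fact, nothing asserted about any limit.

G. 't Hooft, *A property of electric and magnetic flux in non-Abelian gauge theories*, Nucl. Phys. B153 (1979) 141
[tHooft1979Flux] (reprint: C. Rebbi (ed.), *Lattice Gauge Theories and Monte Carlo Simulations*, pp. 546–561), §2 (2.5)–(2.6):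
"there are `N^6` distinct nongauge equivalent choices for the boundary conditions. We can label these by giving the six integers
`n_{μν}` … `n_{4i} = n_i`, `n_{ij} = m_k` … `W{n, m; a_μ} = C ∫_{{n,m}} DA exp S(A)`"; §5 (5.4): "`e^{-βF(e,m;a,β)} =
(1/N³) Σ_k e^{-2πi(k·e)/N} W{k, m; a_μ}`, with `a_4 = β`, and `W` defined as in eq. (2.6)" — the free energy of the state of electric
flux `e ∈ ℤ_N³` and magnetic flux `m`, the `ℤ_N`-Fourier transform over the TEMPORAL twists `k_i = n_{4i}`; §7.2 (7.5): in the
confinement mode the electric fluxes are "heavy", `E(e) → ρ·a` (string constant `ρ`).  Lattice form: Ph. de Forcrand, L. von Smekal,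
Phys. Rev. D66 (2002) 011504 [ForcrandSmekal2002], §"Twisted boundary conditions and electric fluxes" (`Z_k` the twisted partition
functions, `e^{-F(e)/T} ∝ Σ_k e^{-2πi e·k/N} Z_k`).

Here the Euclidean time is the direction `0` of the torus `(ℤ/Lℤ)^{n+1}` (so `a_μ = β = L` for all `μ`: the symmetric box), the
spatial directions are `j.succ`, `j : Fin n`:

* `temporalTensor k` — the twist tensor with temporal entries `n_{0, j+1} = k_j` (`k : Fin n → ZMod N`) and spatial entries `0`;
  a general tensor is `m + temporalTensor k` with `m` carrying the magnetic flux (its own temporal part just shifts `k`);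
* `fluxCharacter e k = ∏_j e^{-2πi k_j e_j/N}` — 't Hooft's Fourier kernel `e^{-2πi(k·e)/N}` (`ZMod.stdAddChar`, which is the
  tree's `centerPhase N`, cf. `QCDTwistedSlab.centerPhase_eq_stdAddChar`);
* `electricFluxWeight N L β m e` — 't Hooft's (5.4) right-hand side `(1/N^n) Σ_k e^{-2πi(k·e)/N} W{m + k; L}` with
  `W{n'; L} = TwistedSector.twistZ (fundamentalRep (Fin N)) (twistOfTensor N n') β L` (the common normalisation constant `C` of
  (2.6) is the one of `twistZ`, the same for all sectors): `e^{-βF(e,m;a,β)}` up to that common constant.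

HONEST FRAMING: a finite-volume definition on the symmetric torus (all `a_μ` equal); nothing about the limits `a_μ → ∞`, the
duality (6.3), or light/heavy fluxes is asserted here (the strong-coupling heaviness of every non-zero electric flux is the theorem
file `THooftElectricFluxStrongCoupling.lean`).  The quantum-mechanical definition (5.1)–(5.3) (trace of the flux projector) is not
formalised; (5.4) is taken as the definition, as in the lattice literature.
-/

noncomputable section

open Finset
open scoped BigOperators
open Literature.MathematicalPhysics.QuantumLattice

namespace Literature.MathematicalPhysics.QuantumFieldTheory

namespace THooftFlux

variable {N n : ℕ}

/-! ### Temporal twists and the Fourier kernel -/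

/-- In a plane `(0, ν)` the second index is non-zero (plumbing for `Fin.pred`). [folklore] -/
private theorem snd_ne_zero_of_fst_eq_zero (q : QuantumLattice.Plane (n + 1)) (h : q.1.1 = 0) : q.1.2 ≠ 0 :=
  (lt_of_eq_of_lt h.symm q.2).ne'

/-- **The temporal twist tensor** of `k : Fin n → ZMod N`: `n_{0, j+1} = k_j` on the temporal planes `(0, j+1)` and `0` on the
spatial planes ('t Hooft (2.5): `n_{4i} = n_i ≡ k_i`; here time is the direction `0`). [cite: tHooft1979Flux, §2 eq. (2.5)] -/
def temporalTensor (k : Fin n → ZMod N) : QuantumLattice.Plane (n + 1) → ZMod N :=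
  fun q => if h : q.1.1 = 0 then k ((q.1.2).pred (snd_ne_zero_of_fst_eq_zero q h)) else 0

/-- On a temporal plane `(0, j+1)` the temporal tensor reads `k_j`. [cite: tHooft1979Flux, §2 eq. (2.5)] -/
theorem temporalTensor_temporal (k : Fin n → ZMod N) (j : Fin n) :
    temporalTensor k ⟨((0 : Fin (n + 1)), j.succ), Fin.succ_pos j⟩ = k j := by
  unfold temporalTensor
  rw [dif_pos rfl]
  simp

/-- On a spatial plane (first index non-zero) the temporal tensor vanishes. [cite: tHooft1979Flux, §2 eq. (2.5)] -/
theorem temporalTensor_of_ne_zero (k : Fin n → ZMod N) (q : QuantumLattice.Plane (n + 1)) (h : q.1.1 ≠ 0) :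
    temporalTensor k q = 0 := by
  unfold temporalTensor
  rw [dif_neg h]

/-- The zero temporal twist is the zero tensor. [cite: tHooft1979Flux, §2 eq. (2.5)] -/
theorem temporalTensor_zero : temporalTensor (0 : Fin n → ZMod N) = 0 := by
  funext q
  unfold temporalTensor
  split_ifs <;> rfl

/-- Temporal tensors add. [cite: tHooft1979Flux, §2 eq. (2.5)] -/
theorem temporalTensor_add (k k' : Fin n → ZMod N) : temporalTensor (k + k') = temporalTensor k + temporalTensor k' := by
  funext q
  unfold temporalTensor
  simp only [Pi.add_apply]
  split_ifs <;> simp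

variable [NeZero N]

/-- **'t Hooft's Fourier kernel** `e^{-2πi(k·e)/N} = ∏_j e^{-2πi k_j e_j/N}` (`ZMod.stdAddChar x = e^{2πi x/N}`).
[cite: tHooft1979Flux, §5 eq. (5.4)] -/
def fluxCharacter (e k : Fin n → ZMod N) : ℂ :=
  ∏ j, (ZMod.stdAddChar (N := N)) (-(k j * e j))

/-- At zero electric flux the kernel is `1`. [cite: tHooft1979Flux, §5 eq. (5.4)] -/
theorem fluxCharacter_zero_left (k : Fin n → ZMod N) : fluxCharacter 0 k = 1 := by
  unfold fluxCharacter
  simp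

/-- At zero temporal twist the kernel is `1`. [cite: tHooft1979Flux, §5 eq. (5.4)] -/
theorem fluxCharacter_zero_right (e : Fin n → ZMod N) : fluxCharacter e 0 = 1 := by
  unfold fluxCharacter
  simp

/-- The kernel has modulus `1`. [cite: tHooft1979Flux, §5 eq. (5.4)] -/
theorem norm_fluxCharacter (e k : Fin n → ZMod N) : ‖fluxCharacter e k‖ = 1 := by
  unfold fluxCharacter
  rw [norm_prod]
  exact Finset.prod_eq_one fun j _ => AddChar.norm_apply _ _

/-! ### The electric-flux weight (5.4) -/

variable (N) in
/-- **'t Hooft's electric-flux weight** `e^{-βF(e,m;a,β)} = (1/N^n) Σ_k e^{-2πi(k·e)/N} W{m + k}` (Nucl. Phys. B153 (1979) 141,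
eq. (5.4), with `n = 3` there): the `ℤ_N`-Fourier transform, over the temporal twists `k`, of the twisted partition functions of the
`SU(N)` Wilson theory on the symmetric torus `(ℤ/Lℤ)^{n+1}` (time = direction `0`, `a_μ = β = L`), at base (magnetic) twist tensor
`m`; `W{n'} = TwistedSector.twistZ (fundamentalRep (Fin N)) (twistOfTensor N n') β L` carries the common normalisation of all sectors.
A complex number (real by `k ↦ -k` symmetry when `W{m+k} = W{m-k}`, not used). [cite: tHooft1979Flux, §5 eq. (5.4)]
[cite: ForcrandSmekal2002, §"Twisted boundary conditions and electric fluxes"] -/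
def electricFluxWeight (L : ℕ) [NeZero L] (β : ℝ) (m : QuantumLattice.Plane (n + 1) → ZMod N) (e : Fin n → ZMod N) : ℂ :=
  ((N : ℂ) ^ n)⁻¹ * ∑ k : Fin n → ZMod N, fluxCharacter e k *
    (TwistedSector.twistZ (fundamentalRep (Fin N)) (QuantumLattice.twistOfTensor N (m + temporalTensor k)) β L : ℂ)

/-- Unfolding (5.4). [cite: tHooft1979Flux, §5 eq. (5.4)] -/
theorem electricFluxWeight_def (L : ℕ) [NeZero L] (β : ℝ) (m : QuantumLattice.Plane (n + 1) → ZMod N) (e : Fin n → ZMod N) :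
    electricFluxWeight N L β m e =
      ((N : ℂ) ^ n)⁻¹ * ∑ k : Fin n → ZMod N, fluxCharacter e k *
        (TwistedSector.twistZ (fundamentalRep (Fin N)) (QuantumLattice.twistOfTensor N (m + temporalTensor k)) β L : ℂ) := rfl

/-- **At zero electric flux the weight is the average of the twisted partition functions over the temporal twists**
(`e = 0`: all `N^n` temporal sectors enter with weight `1`). [cite: tHooft1979Flux, §5 eq. (5.4)] -/
theorem electricFluxWeight_zero (L : ℕ) [NeZero L] (β : ℝ) (m : QuantumLattice.Plane (n + 1) → ZMod N) :
    electricFluxWeight N L β m 0 =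
      ((N : ℂ) ^ n)⁻¹ * ∑ k : Fin n → ZMod N,
        (TwistedSector.twistZ (fundamentalRep (Fin N)) (QuantumLattice.twistOfTensor N (m + temporalTensor k)) β L : ℂ) := by
  rw [electricFluxWeight_def]
  congr 1
  exact Finset.sum_congr rfl fun k _ => by rw [fluxCharacter_zero_left, one_mul]

end THooftFlux

end Literature.MathematicalPhysics.QuantumFieldTheory

end
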